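import Summits.Ventures.LatticeQCDFlow.Exactness.IMHColdStartThaw
import Summits.Ventures.LatticeQCDFlow.Exactness.IMHColdStartMultiTime
import HarnessLib

/-!
# The thaw time and the thawed run: the first accepted configuration of a cold-started exact sampler is a
# perfect sample whenever it arrives, and the run after it is an equilibrium run independent of the thaw time

HONEST FRAMING: exact (Metropolis-corrected) sampling algorithms for lattice gauge theory;
figures of merit are autocorrelation/cost numbers at stated couplings and volumes; no
continuum-physics claim.

Venture `LatticeQCDFlow` (cell pub-lqcd), topic `Exactness`; FANOUT row 30 (lean-1, GEN-33).  NEW WORK of the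
cell, general state space with an ATOM-FREE proposal (`q{x₀} = 0`, so "accepted" = "moved").  `K = indepMH q w`,
`x₀` a mode of the normalised weight `w`, `A = 1/w(x₀)`, `r = 1 − A`, `P_μ` the chain law on path space.  GEN-31
said it in words («cold start + first acceptance = von Neumann rejection sampling; the first accepted configuration
is an exact sample») and proved the kernel identity `K(x₀,·) = A·π + r·δ_{x₀}`; here it is a theorem about the RUN.
The thaw time is `T = t + 1` on the event `{X_0 = … = X_t = x₀, X_{t+1} ≠ x₀}` (events pairwise disjoint in `t`):

* §1 bookkeeping: under the equilibrium run every fixed coordinate avoids `x₀` almost surely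
  (**`imh_chain_stationary_eval_eq_null`**), measurability of the thaw events, and what the padding maps of
  `IMHColdStartThaw` do to them.
* §2 **`imh_chain_thawAt_inter_shift`** — THE JOINT LAW OF THE THAW TIME AND THE THAWED RUN: for every `t` and every
  measurable set of paths `E`,
  `P_{x₀}(X_0 = … = X_t = x₀, X_{t+1} ≠ x₀, (X_{t+1+n})_n ∈ E) = A r^t · P_π(E)` EXACTLY
  (from the thaw decomposition `P_{x₀} = Σ_s A r^s (pad_{s+1})_* P_π`: only the summand `s = t` sees the event);
  hence **`imh_chain_thawAt`** `P_{x₀}(T = t + 1) = A r^t` (geometric thaw time, mean `1/A`),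
  **`imh_chain_thawAt_inter_shift_eq_mul`** `P_{x₀}(T = t+1, X_{T+·} ∈ E) = P_{x₀}(T = t+1)·P_π(E)` — THE THAWED RUN
  IS AN EQUILIBRIUM RUN INDEPENDENT OF THE THAW TIME — and **`imh_chain_firstAccepted`**
  `P_{x₀}(T = t+1, X_T ∈ B) = A r^t·π(B)`: THE FIRST ACCEPTED CONFIGURATION IS A PERFECT SAMPLE WHENEVER IT ARRIVES.
* §3 summed over the arrival time: **`imh_chain_thaw_hasSum_one`** `Σ_t P_{x₀}(T = t+1) = 1` (the run thaws almost
  surely) and **`imh_chain_thawedRun`** `P_{x₀}(⋃_t {T = t+1, X_{T+·} ∈ E}) = P_π(E)`: THE RUN RECORDED FROM THE FIRST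
  ACCEPTED CONFIGURATION ON IS, IN LAW, EXACTLY THE EQUILIBRIUM RUN — discarding the frozen prefix (a stopping rule
  the seat can apply online, at expected cost `1/A`) removes the cold start COMPLETELY, where discarding any FIXED
  number `b` of updates leaves the fraction `r^b` (`IMHColdStartPathMixture`).

Reading (gauge files `Scaling/AutoregressiveGauge…ThawTime`): for both exact gauge samplers started cold
(`A = Z/(c^{#B}M^k)` resp. `Z/∏_ℓ c_{#C_ℓ}`, Haar proposal marginals atom-free), the first configuration different
from the cold one is exactly Boltzmann-distributed, arrives at a geometric time of mean `1/A`, and everything recorded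
from it on is an equilibrium run.  NOT CLAIMED: proposals with an atom at `x₀` (then "moved" under-counts
"accepted"; the decomposition of `IMHColdStartThaw` still holds); non-modal starts.

No `sorry`, no new definitions, nothing cited as a fact; general measurable space with measurable singletons.
-/

noncomputable section

namespace Summit.Ventures.LatticeQCDFlow.Exactness

open MeasureTheory ProbabilityTheory Function Finset Filter
open scoped ENNReal Topology
open Summit.Ventures.LatticeQCDFlow.Scoring

variable {Ω : Type*} [MeasurableSpace Ω] [MeasurableSingletonClass Ω]
variable {q : Measure Ω} [IsProbabilityMeasure q] {w : Ω → ℝ}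

/-! ## §1 Bookkeeping -/

omit [MeasurableSingletonClass Ω] in
/-- **The equilibrium run has marginal `π` at every time, as a measure**: `P_π(X_s ∈ B) = π(B)`. [ours, bookkeeping]
-/
theorem imh_chain_stationary_eval [Fact (Measurable w)] (hw0 : ∀ y, 0 < w y)
    [IsProbabilityMeasure (q.withDensity fun y => ENNReal.ofReal (w y))] (s : ℕ) {B : Set Ω}
    (hB : MeasurableSet B) :
    Kernel.trajMeasure (X := fun _ : ℕ => Ω) (q.withDensity fun y => ENNReal.ofReal (w y))
        (fun n : ℕ => (indepMH q w).comap (fun h : (i : ↥(Finset.Iic n)) → Ω => h ⟨n, Finset.mem_Iic.2 le_rfl⟩)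
          (measurable_pi_apply _)) {x : ℕ → Ω | x s ∈ B} =
      (q.withDensity fun y => ENNReal.ofReal (w y)) B := by
  rw [show {x : ℕ → Ω | x s ∈ B} = (fun x : ℕ → Ω => x s) ⁻¹' B from rfl,
    ← Measure.map_apply (measurable_pi_apply s) hB, chain_map_eval (indepMH q w) _ s,
    iterate_bind_indepMH_invariant Fact.out hw0 s]

/-- **Under the equilibrium run every fixed coordinate avoids the atom-free point `x₀` almost surely**:
`P_π(X_s = x₀) = 0`. [ours, bookkeeping] -/
theorem imh_chain_stationary_eval_eq_null [Fact (Measurable w)] (hw0 : ∀ y, 0 < w y) {x₀ : Ω}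
    (hqx : q {x₀} = 0) [IsProbabilityMeasure (q.withDensity fun y => ENNReal.ofReal (w y))] (s : ℕ) :
    Kernel.trajMeasure (X := fun _ : ℕ => Ω) (q.withDensity fun y => ENNReal.ofReal (w y))
        (fun n : ℕ => (indepMH q w).comap (fun h : (i : ↥(Finset.Iic n)) → Ω => h ⟨n, Finset.mem_Iic.2 le_rfl⟩)
          (measurable_pi_apply _)) {x : ℕ → Ω | x s = x₀} = 0 := by
  have h := imh_chain_stationary_eval (q := q) hw0 s (measurableSet_singleton x₀)
  rw [withDensity_singleton_eq_zero hqx] at h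
  exact h

omit [MeasurableSingletonClass Ω] in
/-- The thaw event `{X_0 = … = X_t = x₀, X_{t+1} ≠ x₀, X_{t+1+·} ∈ E}` is measurable. [ours, bookkeeping] -/
theorem measurableSet_thawAt [MeasurableSingletonClass Ω] (x₀ : Ω) (t : ℕ) {E : Set (ℕ → Ω)}
    (hE : MeasurableSet E) :
    MeasurableSet {x : ℕ → Ω | (∀ i, i ≤ t → x i = x₀) ∧ x (t + 1) ≠ x₀ ∧ (fun n => x (t + 1 + n)) ∈ E} := by
  have hΘ : Measurable (fun (x : ℕ → Ω) (n : ℕ) => x (t + 1 + n)) :=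
    measurable_pi_lambda _ fun n => measurable_pi_apply _
  have h1 : MeasurableSet {x : ℕ → Ω | ∀ i, i ≤ t → x i = x₀} := by
    have : {x : ℕ → Ω | ∀ i, i ≤ t → x i = x₀} = ⋂ i ∈ Finset.range (t + 1), (fun x : ℕ → Ω => x i) ⁻¹' {x₀} := by
      ext x
      simp only [Set.mem_setOf_eq, Set.mem_iInter, Set.mem_preimage, Set.mem_singleton_iff, Finset.mem_range,
        Nat.lt_succ_iff]
    rw [this]
    exact MeasurableSet.biInter (Set.to_countable _) fun i _ => (measurable_pi_apply i) (measurableSet_singleton x₀)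
  have h2 : MeasurableSet {x : ℕ → Ω | x (t + 1) ≠ x₀} := by
    show MeasurableSet ((fun x : ℕ → Ω => x (t + 1)) ⁻¹' {x₀})ᶜ
    exact ((measurable_pi_apply (t + 1)) (measurableSet_singleton x₀)).compl
  rw [Set.setOf_and, Set.setOf_and]
  exact h1.inter (h2.inter (hΘ hE))

omit [MeasurableSpace Ω] [MeasurableSingletonClass Ω] in
/-- What `pad_{s+1}` does to the thaw event at `t`: for `s = t` its preimage is `{y_0 ≠ x₀} ∩ E`. [ours, bookkeeping]
-/
theorem pad_preimage_thawAt_self (x₀ : Ω) (t : ℕ) (E : Set (ℕ → Ω)) :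
    (fun (y : ℕ → Ω) (m : ℕ) => if m < t + 1 then x₀ else y (m - (t + 1))) ⁻¹'
        {x : ℕ → Ω | (∀ i, i ≤ t → x i = x₀) ∧ x (t + 1) ≠ x₀ ∧ (fun n => x (t + 1 + n)) ∈ E} =
      {y : ℕ → Ω | y 0 ≠ x₀} ∩ E := by
  ext y
  simp only [Set.mem_preimage, Set.mem_setOf_eq, Set.mem_inter_iff, lt_irrefl, if_false, Nat.sub_self]
  have h3 : (fun n => if t + 1 + n < t + 1 then x₀ else y (t + 1 + n - (t + 1))) = y := by
    funext n
    rw [if_neg (by omega), Nat.add_sub_cancel_left]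
  rw [h3]
  constructor
  · rintro ⟨-, h2, h4⟩; exact ⟨h2, h4⟩
  · rintro ⟨h2, h4⟩; exact ⟨fun i hi => by rw [if_pos (Nat.lt_succ_of_le hi)], h2, h4⟩

omit [MeasurableSpace Ω] [MeasurableSingletonClass Ω] in
/-- For `t < s` the preimage is empty (the padded run is still frozen at time `t + 1`). [ours, bookkeeping] -/
theorem pad_preimage_thawAt_of_lt (x₀ : Ω) {t s : ℕ} (hts : t < s) (E : Set (ℕ → Ω)) :
    (fun (y : ℕ → Ω) (m : ℕ) => if m < s + 1 then x₀ else y (m - (s + 1))) ⁻¹'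
        {x : ℕ → Ω | (∀ i, i ≤ t → x i = x₀) ∧ x (t + 1) ≠ x₀ ∧ (fun n => x (t + 1 + n)) ∈ E} = ∅ := by
  ext y
  simp only [Set.mem_preimage, Set.mem_setOf_eq, Set.mem_empty_iff_false, iff_false, not_and]
  intro _ h2
  exact absurd (by rw [if_pos (by omega)]) h2

omit [MeasurableSpace Ω] [MeasurableSingletonClass Ω] in
/-- For `s < t` the preimage lies in `{y_{t−s−1} = x₀}` (the equilibrium run would have to sit at `x₀`). [ours,
bookkeeping] -/
theorem pad_preimage_thawAt_of_gt (x₀ : Ω) {t s : ℕ} (hst : s < t) (E : Set (ℕ → Ω)) :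
    (fun (y : ℕ → Ω) (m : ℕ) => if m < s + 1 then x₀ else y (m - (s + 1))) ⁻¹'
        {x : ℕ → Ω | (∀ i, i ≤ t → x i = x₀) ∧ x (t + 1) ≠ x₀ ∧ (fun n => x (t + 1 + n)) ∈ E} ⊆
      {y : ℕ → Ω | y (t - (s + 1)) = x₀} := by
  intro y hy
  simp only [Set.mem_preimage, Set.mem_setOf_eq] at hy ⊢
  have h := hy.1 t le_rfl
  rwa [if_neg (by omega)] at h

/-! ## §2 The joint law of the thaw time and the thawed run -/

/-- **THE JOINT LAW OF THE THAW TIME AND THE THAWED RUN.**  `w` measurable (a `Fact`), positive, normalised, maximal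
at `x₀`, proposal atom-free at `x₀`; `A = 1/w(x₀)`, `r = 1 − A`.  For every `t` and every measurable set of paths `E`:
`P_{x₀}(X_0 = … = X_t = x₀, X_{t+1} ≠ x₀, (X_{t+1+n})_n ∈ E) = A r^t · P_π(E)`. [ours] -/
theorem imh_chain_thawAt_inter_shift [Fact (Measurable w)] (hw0 : ∀ y, 0 < w y) {x₀ : Ω} (hmax : ∀ y, w y ≤ w x₀)
    (hqx : q {x₀} = 0) [IsProbabilityMeasure (q.withDensity fun y => ENNReal.ofReal (w y))] (t : ℕ)
    {E : Set (ℕ → Ω)} (hE : MeasurableSet E) :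
    Kernel.trajMeasure (X := fun _ : ℕ => Ω) (Measure.dirac x₀)
        (fun n : ℕ => (indepMH q w).comap (fun h : (i : ↥(Finset.Iic n)) → Ω => h ⟨n, Finset.mem_Iic.2 le_rfl⟩)
          (measurable_pi_apply _))
        {x : ℕ → Ω | (∀ i, i ≤ t → x i = x₀) ∧ x (t + 1) ≠ x₀ ∧ (fun n => x (t + 1 + n)) ∈ E} =
      ENNReal.ofReal ((w x₀)⁻¹ * (1 - (w x₀)⁻¹) ^ t) *
        Kernel.trajMeasure (X := fun _ : ℕ => Ω) (q.withDensity fun y => ENNReal.ofReal (w y))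
          (fun n : ℕ => (indepMH q w).comap (fun h : (i : ↥(Finset.Iic n)) → Ω => h ⟨n, Finset.mem_Iic.2 le_rfl⟩)
            (measurable_pi_apply _)) E := by
  set Pπ := Kernel.trajMeasure (X := fun _ : ℕ => Ω) (q.withDensity fun y => ENNReal.ofReal (w y))
      (fun n : ℕ => (indepMH q w).comap (fun h : (i : ↥(Finset.Iic n)) → Ω => h ⟨n, Finset.mem_Iic.2 le_rfl⟩)
        (measurable_pi_apply _)) with hPπ
  have hS := measurableSet_thawAt x₀ t hE
  rw [imh_chain_thaw_sum hw0 hmax, Measure.sum_apply _ hS]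
  simp only [Measure.smul_apply, smul_eq_mul]
  rw [tsum_eq_single t]
  · rw [Measure.map_apply (measurable_pad x₀ (t + 1)) hS, pad_preimage_thawAt_self]
    congr 1
    rw [show {y : ℕ → Ω | y 0 ≠ x₀} ∩ E = E \ {y : ℕ → Ω | y 0 = x₀} by
      ext y; simp only [Set.mem_inter_iff, Set.mem_setOf_eq, Set.mem_sdiff]; tauto]
    exact measure_sdiff_null (imh_chain_stationary_eval_eq_null hw0 hqx 0)
  · intro s hs
    rw [Measure.map_apply (measurable_pad x₀ (s + 1)) hS]
    rcases lt_or_gt_of_ne hs with h | h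
    · rw [measure_mono_null (pad_preimage_thawAt_of_gt x₀ h E) (imh_chain_stationary_eval_eq_null hw0 hqx _),
        mul_zero]
    · rw [pad_preimage_thawAt_of_lt x₀ h E, measure_empty, mul_zero]

/-- **THE THAW TIME IS GEOMETRIC**: `P_{x₀}(X_0 = … = X_t = x₀, X_{t+1} ≠ x₀) = A r^t` (`= P(T = t + 1)`; mean
`1/A = w(x₀)`, GEN-31's expected frozen time). [ours] -/
theorem imh_chain_thawAt [Fact (Measurable w)] (hw0 : ∀ y, 0 < w y) {x₀ : Ω} (hmax : ∀ y, w y ≤ w x₀)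
    (hqx : q {x₀} = 0) [IsProbabilityMeasure (q.withDensity fun y => ENNReal.ofReal (w y))] (t : ℕ) :
    Kernel.trajMeasure (X := fun _ : ℕ => Ω) (Measure.dirac x₀)
        (fun n : ℕ => (indepMH q w).comap (fun h : (i : ↥(Finset.Iic n)) → Ω => h ⟨n, Finset.mem_Iic.2 le_rfl⟩)
          (measurable_pi_apply _))
        {x : ℕ → Ω | (∀ i, i ≤ t → x i = x₀) ∧ x (t + 1) ≠ x₀} =
      ENNReal.ofReal ((w x₀)⁻¹ * (1 - (w x₀)⁻¹) ^ t) := by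
  have h := imh_chain_thawAt_inter_shift (q := q) hw0 hmax hqx t MeasurableSet.univ (x₀ := x₀)
  simp only [Set.mem_univ, and_true, measure_univ, mul_one] at h
  exact h

/-- Real-valued form: `P_{x₀}(T = t + 1) = A r^t`. [ours] -/
theorem imh_chain_thawAt_real [Fact (Measurable w)] (hw0 : ∀ y, 0 < w y) {x₀ : Ω} (hmax : ∀ y, w y ≤ w x₀)
    (hqx : q {x₀} = 0) [IsProbabilityMeasure (q.withDensity fun y => ENNReal.ofReal (w y))] (t : ℕ) :
    (Kernel.trajMeasure (X := fun _ : ℕ => Ω) (Measure.dirac x₀)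
        (fun n : ℕ => (indepMH q w).comap (fun h : (i : ↥(Finset.Iic n)) → Ω => h ⟨n, Finset.mem_Iic.2 le_rfl⟩)
          (measurable_pi_apply _))).real
        {x : ℕ → Ω | (∀ i, i ≤ t → x i = x₀) ∧ x (t + 1) ≠ x₀} = (w x₀)⁻¹ * (1 - (w x₀)⁻¹) ^ t := by
  have hA0 : 0 ≤ (w x₀)⁻¹ := inv_nonneg.mpr (hw0 x₀).le
  have hW : 1 ≤ w x₀ := one_le_of_mode (q := q) hmax
  have hr0 : 0 ≤ 1 - (w x₀)⁻¹ := sub_nonneg.2 (inv_le_one_of_one_le₀ hW)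
  rw [Measure.real, imh_chain_thawAt hw0 hmax hqx t, ENNReal.toReal_ofReal (mul_nonneg hA0 (pow_nonneg hr0 t))]

/-- **THE THAWED RUN IS AN EQUILIBRIUM RUN INDEPENDENT OF THE THAW TIME**:
`P_{x₀}(T = t+1, (X_{T+n})_n ∈ E) = P_{x₀}(T = t+1) · P_π(E)` for every `t` and every measurable set of paths `E`.
[ours] -/
theorem imh_chain_thawAt_inter_shift_eq_mul [Fact (Measurable w)] (hw0 : ∀ y, 0 < w y) {x₀ : Ω}
    (hmax : ∀ y, w y ≤ w x₀) (hqx : q {x₀} = 0)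
    [IsProbabilityMeasure (q.withDensity fun y => ENNReal.ofReal (w y))] (t : ℕ) {E : Set (ℕ → Ω)}
    (hE : MeasurableSet E) :
    Kernel.trajMeasure (X := fun _ : ℕ => Ω) (Measure.dirac x₀)
        (fun n : ℕ => (indepMH q w).comap (fun h : (i : ↥(Finset.Iic n)) → Ω => h ⟨n, Finset.mem_Iic.2 le_rfl⟩)
          (measurable_pi_apply _))
        {x : ℕ → Ω | (∀ i, i ≤ t → x i = x₀) ∧ x (t + 1) ≠ x₀ ∧ (fun n => x (t + 1 + n)) ∈ E} =
      Kernel.trajMeasure (X := fun _ : ℕ => Ω) (Measure.dirac x₀)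
          (fun n : ℕ => (indepMH q w).comap (fun h : (i : ↥(Finset.Iic n)) → Ω => h ⟨n, Finset.mem_Iic.2 le_rfl⟩)
            (measurable_pi_apply _))
          {x : ℕ → Ω | (∀ i, i ≤ t → x i = x₀) ∧ x (t + 1) ≠ x₀} *
        Kernel.trajMeasure (X := fun _ : ℕ => Ω) (q.withDensity fun y => ENNReal.ofReal (w y))
          (fun n : ℕ => (indepMH q w).comap (fun h : (i : ↥(Finset.Iic n)) → Ω => h ⟨n, Finset.mem_Iic.2 le_rfl⟩)
            (measurable_pi_apply _)) E := by
  rw [imh_chain_thawAt_inter_shift hw0 hmax hqx t hE, imh_chain_thawAt hw0 hmax hqx t]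

/-- **THE FIRST ACCEPTED CONFIGURATION IS A PERFECT SAMPLE WHENEVER IT ARRIVES**:
`P_{x₀}(X_0 = … = X_t = x₀, X_{t+1} ≠ x₀, X_{t+1} ∈ B) = A r^t · π(B)` for every `t` and every measurable `B`. [ours]
-/
theorem imh_chain_firstAccepted [Fact (Measurable w)] (hw0 : ∀ y, 0 < w y) {x₀ : Ω} (hmax : ∀ y, w y ≤ w x₀)
    (hqx : q {x₀} = 0) [IsProbabilityMeasure (q.withDensity fun y => ENNReal.ofReal (w y))] (t : ℕ) {B : Set Ω}
    (hB : MeasurableSet B) :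
    Kernel.trajMeasure (X := fun _ : ℕ => Ω) (Measure.dirac x₀)
        (fun n : ℕ => (indepMH q w).comap (fun h : (i : ↥(Finset.Iic n)) → Ω => h ⟨n, Finset.mem_Iic.2 le_rfl⟩)
          (measurable_pi_apply _))
        {x : ℕ → Ω | (∀ i, i ≤ t → x i = x₀) ∧ x (t + 1) ≠ x₀ ∧ x (t + 1) ∈ B} =
      ENNReal.ofReal ((w x₀)⁻¹ * (1 - (w x₀)⁻¹) ^ t) * (q.withDensity fun y => ENNReal.ofReal (w y)) B := by
  have hE : MeasurableSet {y : ℕ → Ω | y 0 ∈ B} := (measurable_pi_apply 0) hB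
  have h := imh_chain_thawAt_inter_shift (q := q) hw0 hmax hqx t hE (x₀ := x₀)
  rw [imh_chain_stationary_eval hw0 0 hB] at h
  rw [← h]
  rfl

/-! ## §3 Summed over the arrival time: the run thaws almost surely, and the thawed run is the equilibrium run -/

omit [MeasurableSpace Ω] [MeasurableSingletonClass Ω] in
/-- The thaw events are pairwise disjoint in `t`. [ours, bookkeeping] -/
theorem disjoint_thawAt (x₀ : Ω) (E : ℕ → Set (ℕ → Ω)) :
    Pairwise (Function.onFun Disjoint fun t : ℕ =>
      {x : ℕ → Ω | (∀ i, i ≤ t → x i = x₀) ∧ x (t + 1) ≠ x₀ ∧ (fun n => x (t + 1 + n)) ∈ E t}) := by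
  intro t t' htt'
  rw [Function.onFun, Set.disjoint_left]
  rintro x ⟨h1, h2, -⟩ ⟨h1', h2', -⟩
  rcases lt_or_gt_of_ne htt' with h | h
  · exact h2 (h1' (t + 1) h)
  · exact h2' (h1 (t' + 1) h)

omit [MeasurableSingletonClass Ω] in
/-- `Σ_t A r^t = 1`. [ours, bookkeeping] -/
theorem hasSum_thaw_weights (hw0 : ∀ y, 0 < w y) {x₀ : Ω} (hmax : ∀ y, w y ≤ w x₀)
    [IsProbabilityMeasure (q.withDensity fun y => ENNReal.ofReal (w y))] :
    HasSum (fun t : ℕ => (w x₀)⁻¹ * (1 - (w x₀)⁻¹) ^ t) 1 := by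
  have hA0 : 0 < (w x₀)⁻¹ := inv_pos.mpr (hw0 x₀)
  have hW : 1 ≤ w x₀ := one_le_of_mode (q := q) hmax
  have hr0 : 0 ≤ 1 - (w x₀)⁻¹ := sub_nonneg.2 (inv_le_one_of_one_le₀ hW)
  have hr1 : 1 - (w x₀)⁻¹ < 1 := sub_lt_self _ hA0
  have h := (hasSum_geometric_of_lt_one hr0 hr1).mul_left (w x₀)⁻¹
  rwa [sub_sub_cancel, mul_inv_cancel₀ hA0.ne'] at h

/-- **THE THAWED RUN IS EXACTLY THE EQUILIBRIUM RUN**: for every measurable set of paths `E`,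
`P_{x₀}(⋃_t {X_0 = … = X_t = x₀, X_{t+1} ≠ x₀, (X_{t+1+n})_n ∈ E}) = P_π(E)` — the run recorded from the first
accepted configuration on has the law of the equilibrium run. [ours] -/
theorem imh_chain_thawedRun [Fact (Measurable w)] (hw0 : ∀ y, 0 < w y) {x₀ : Ω} (hmax : ∀ y, w y ≤ w x₀)
    (hqx : q {x₀} = 0) [IsProbabilityMeasure (q.withDensity fun y => ENNReal.ofReal (w y))] {E : Set (ℕ → Ω)}
    (hE : MeasurableSet E) :
    Kernel.trajMeasure (X := fun _ : ℕ => Ω) (Measure.dirac x₀)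
        (fun n : ℕ => (indepMH q w).comap (fun h : (i : ↥(Finset.Iic n)) → Ω => h ⟨n, Finset.mem_Iic.2 le_rfl⟩)
          (measurable_pi_apply _))
        (⋃ t : ℕ, {x : ℕ → Ω | (∀ i, i ≤ t → x i = x₀) ∧ x (t + 1) ≠ x₀ ∧ (fun n => x (t + 1 + n)) ∈ E}) =
      Kernel.trajMeasure (X := fun _ : ℕ => Ω) (q.withDensity fun y => ENNReal.ofReal (w y))
        (fun n : ℕ => (indepMH q w).comap (fun h : (i : ↥(Finset.Iic n)) → Ω => h ⟨n, Finset.mem_Iic.2 le_rfl⟩)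
          (measurable_pi_apply _)) E := by
  have hA0 : 0 ≤ (w x₀)⁻¹ := inv_nonneg.mpr (hw0 x₀).le
  have hW : 1 ≤ w x₀ := one_le_of_mode (q := q) hmax
  have hr0 : 0 ≤ 1 - (w x₀)⁻¹ := sub_nonneg.2 (inv_le_one_of_one_le₀ hW)
  rw [measure_iUnion (disjoint_thawAt x₀ fun _ => E) (fun t => measurableSet_thawAt x₀ t hE)]
  simp_rw [imh_chain_thawAt_inter_shift hw0 hmax hqx _ hE]
  rw [ENNReal.tsum_mul_right, ← ENNReal.ofReal_tsum_of_nonneg (fun t => mul_nonneg hA0 (pow_nonneg hr0 t))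
    (hasSum_thaw_weights (q := q) hw0 hmax).summable, (hasSum_thaw_weights (q := q) hw0 hmax).tsum_eq,
    ENNReal.ofReal_one, one_mul]

/-- **THE RUN THAWS ALMOST SURELY**: `P_{x₀}(⋃_t {X_0 = … = X_t = x₀, X_{t+1} ≠ x₀}) = 1`, i.e. `Σ_t A r^t = 1` as
probabilities of the disjoint thaw events. [ours] -/
theorem imh_chain_thaws [Fact (Measurable w)] (hw0 : ∀ y, 0 < w y) {x₀ : Ω} (hmax : ∀ y, w y ≤ w x₀)
    (hqx : q {x₀} = 0) [IsProbabilityMeasure (q.withDensity fun y => ENNReal.ofReal (w y))] :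
    Kernel.trajMeasure (X := fun _ : ℕ => Ω) (Measure.dirac x₀)
        (fun n : ℕ => (indepMH q w).comap (fun h : (i : ↥(Finset.Iic n)) → Ω => h ⟨n, Finset.mem_Iic.2 le_rfl⟩)
          (measurable_pi_apply _))
        (⋃ t : ℕ, {x : ℕ → Ω | (∀ i, i ≤ t → x i = x₀) ∧ x (t + 1) ≠ x₀}) = 1 := by
  have h := imh_chain_thawedRun (q := q) hw0 hmax hqx MeasurableSet.univ (x₀ := x₀)
  simp only [Set.mem_univ, and_true, measure_univ] at h
  exact h

/-- **The first accepted configuration, summed over its arrival time, is exactly `π`-distributed**: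
`P_{x₀}(⋃_t {X_0 = … = X_t = x₀, X_{t+1} ≠ x₀, X_{t+1} ∈ B}) = π(B)`. [ours] -/
theorem imh_chain_firstAccepted_total [Fact (Measurable w)] (hw0 : ∀ y, 0 < w y) {x₀ : Ω}
    (hmax : ∀ y, w y ≤ w x₀) (hqx : q {x₀} = 0)
    [IsProbabilityMeasure (q.withDensity fun y => ENNReal.ofReal (w y))] {B : Set Ω} (hB : MeasurableSet B) :
    Kernel.trajMeasure (X := fun _ : ℕ => Ω) (Measure.dirac x₀)
        (fun n : ℕ => (indepMH q w).comap (fun h : (i : ↥(Finset.Iic n)) → Ω => h ⟨n, Finset.mem_Iic.2 le_rfl⟩)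
          (measurable_pi_apply _))
        (⋃ t : ℕ, {x : ℕ → Ω | (∀ i, i ≤ t → x i = x₀) ∧ x (t + 1) ≠ x₀ ∧ x (t + 1) ∈ B}) =
      (q.withDensity fun y => ENNReal.ofReal (w y)) B := by
  have hE : MeasurableSet {y : ℕ → Ω | y 0 ∈ B} := (measurable_pi_apply 0) hB
  have h := imh_chain_thawedRun (q := q) hw0 hmax hqx hE (x₀ := x₀)
  rw [imh_chain_stationary_eval hw0 0 hB] at h
  rw [← h]
  rfl

end Summit.Ventures.LatticeQCDFlow.Exactness
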